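import Summits.BirchSwinnertonDyer.BirchSwinnertonDyer.Theses.CyclotomicUntwist
import Summits.BirchSwinnertonDyer.BirchSwinnertonDyer.Theorems.CyclotomicUntwistPSUntwistedTraceDefs
import Literature.NumberTheory.EllipticCurves.DescendedFrobeniusMatrix
import Literature.Barriers.BirchSwinnertonDyer.ExceptionalZero
import HarnessLib

/-!
# Route `CyclotomicUntwist`, K2 side: the FINITENESS CORNER of the Kato-side child C5≤ and the reshaped stub S5≤ (v6)

Cell `pub/bsd-wall` (D-0145 line `route-BirchSwinnertonDyer-CyclotomicUntwist`), seat `bsd-line-cycu-p1` (K1/K2 LEAD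
lineage, gen 8). THEOREMS ONLY (no definition, no named fact, no `sorry`); helper `--supports` K2 =
stmt-BirchSwinnertonDyer-21581 (`PSRankOneUpperHalfAtThree`). BSD is not proved by this file; no crux and no child of the
route is proved by it; K1/K2 stay OPEN and WHOLE.

WHAT. The K-SEP child C5≤ = item stmt-BirchSwinnertonDyer-27592
`Theses.CyclotomicUntwist.PSpAdicBSDKatoSideDescendedEigenlineAtThree` («N-pBSD₃′ at the descended-Frobenius eigenline,
KATO DIRECTION ONLY») concludes `‖c₁(𝓛)ϖ‖·‖log₃γ‖ ≤ ‖9η(−1)/α²‖·‖#Ш·∏c_ℓ/#tors²‖₃·‖ι h_ψ(P,P)‖` with `#Ш = W.shaOrder =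
Nat.card Ш(E/ℚ)`, whose junk value is `0` when `Ш(E/ℚ)` is infinite. Hence (§1, `gammaMahlerCoeff_mul_eq_zero_of_kato_child_of_not_finite_sha`):
on a principal-series row where `Ш(E)` is NOT finite, the filed child asserts `c₁(𝓛)·ϖ = 0` for every admissible datum at
which a point `P` with `ĥ(P) = Reg` exists (`log₃ γ ≠ 0` is the tree theorem
`Literature.Barriers.BirchSwinnertonDyer.padicLog_cyclotomicGenerator_ne_zero`). In truth `Ш(E)` is finite at `r_an = 1`
(Gross–Zagier–Kolyvagin, the route's print input `PublishedInputGZK`, item 19921) — but a PROOF of the child as filed must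
therefore contain a proof of the finiteness of the WHOLE of `Ш(E)` on these rows (or of `c₁ϖ = 0`, false in truth), an input of
Kolyvagin strength that the «Kato direction» (Kato's divisibility for the untwist `g`, descended to `E`) does not supply: Kato-side
methods bound `#Ш[3^∞]` from above GIVEN finiteness, or give finiteness of the `3`-primary part only.

The LEAD's reshaped stub S5≤ (skeleton `Lines/dfrob_kato.lean` v6 of crux K2) therefore carries ONE extra binder `Finite W.sha →`
after `W.analyticRank = 1 →`; inside the K2 composition it is discharged by the print stub S6 = `PublishedInputGZK`. §2 records the
bookkeeping, sorry-free: the filed item IMPLIES the reshaped stub (`stub_pBSD3le_v6_of_item`, weakening), and conversely the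
reshaped stub gives the filed item back GRANTED GZK (`item_of_gzk_of_stub_pBSD3le_v6`) — so exactly the finiteness of `Ш` was
removed, nothing else. The K1-side children have no such corner: an infinite `Ш` makes C5≥ (27614) trivially true and does not
enter C4 (27546).

References: [cite: Miller2011LMS, Def. 1.1 (arXiv:1010.2431 p. 3)] (the `#Ш_an`/`BSD(E,p)` currency and its junk conventions) ·
[cite: Kato2004Asterisque, Thm. 12.5 and §17] (what the Kato direction delivers) · [cite: MazurTateTeitelbaum1986Invent, §I.13]
(`d/ds = log_p γ · d/dT`, `log_p γ ≠ 0`).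
-/

set_option autoImplicit false
-- single-conjunct summit: `Summit.BirchSwinnertonDyer.BirchSwinnertonDyer.…` repeats the name by design
set_option linter.dupNamespace false

noncomputable section

open scoped Classical MatrixGroups

open CongruenceSubgroup WeierstrassCurve WeierstrassCurve.Affine.Point Literature.NumberTheory.EllipticCurves
  Literature.NumberTheory.EllipticCurves.ModularForms Literature.NumberTheory.EllipticCurves.Rank1Residual
  Literature.NumberTheory.IwasawaTheory Summit.BirchSwinnertonDyer.Rank1Residual.Additive
  Summit.BirchSwinnertonDyer.BirchSwinnertonDyer.Theses.CyclotomicUntwist IsCyclotomicExtension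

namespace Summit.BirchSwinnertonDyer.BirchSwinnertonDyer.Theorems.CyclotomicUntwistKSepKatoSideFinitenessCorner

/-! ### §1 The finiteness corner of the filed child C5≤ (27592) -/

/-- **The finiteness corner.** Granted the filed Kato-side child C5≤ (`PSpAdicBSDKatoSideDescendedEigenlineAtThree`,
item 27592, as a hypothesis): on a principal-series row (`¬CM`, `ClassO6` at `3`, `ρ̄₃` onto, `v₃Δ_min` even with unit part
`≡ 1 (mod 3)`, `r_an = 1`) on which `Ш(E/ℚ)` is NOT finite, for every admissible datum `(η, α, 𝓛, ϖ)`, THE descended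
Frobenius matrix `M` with eigenline coordinates `(a, b)`, every pinned line-height datum `Dh` and every point `P` with
`ĥ(P) = Reg`, the child forces `c₁(𝓛)·ϖ = 0` (`W.shaOrder = Nat.card Ш = 0` is junk, `log₃ γ ≠ 0`). So a proof of the
filed child must prove finiteness of all of `Ш(E)` on these rows — Kolyvagin-strength, not Kato-side.
[cite: Miller2011LMS, Def. 1.1 (arXiv:1010.2431 p. 3)] [cite: MazurTateTeitelbaum1986Invent, §I.13] -/
theorem gammaMahlerCoeff_mul_eq_zero_of_kato_child_of_not_finite_sha
    (h : PSpAdicBSDKatoSideDescendedEigenlineAtThree)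
    (ψ : DirichletCharacter (CyclotomicField 3 ℚ_[3]) 9) (ι : CyclotomicField 3 ℚ_[3] →ₐ[ℚ_[3]] ℂ_[3])
    (hψ : ψ (2 : ZMod 9) = zeta 3 ℚ_[3] (CyclotomicField 3 ℚ_[3])) (hι : Function.Injective ι)
    (W : WeierstrassCurve ℚ) [W.IsElliptic] [W.IsGloballyMinimal] (hCM : ¬ W.HasCM)
    (hO6 : Summit.BirchSwinnertonDyer.Rank1Residual.Additive.ClassO6 W 3) (hsurj : Surj W 3)
    (hev : Even (padicValInt 3 W.minimalDiscriminantInt))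
    (hsq : W.minimalDiscriminantInt / 3 ^ padicValInt 3 W.minimalDiscriminantInt % 3 = 1)
    (hr : W.analyticRank = 1) (hinf : ¬ Finite W.sha)
    (η : DirichletCharacter ℂ_[3] (3 ^ 2)) (α : ℂ_[3]) (𝓛 : (n : ℕ) → ZMod (3 ^ n) → ℂ_[3]) (ϖ : ℚ)
    (hη : η.IsPrimitive) (hroot : α ^ 2 - ((W.psUntwistedTrace : ℤ) : ℂ_[3]) * α + 3 = 0)
    (hμ : IsPSCyclotomicLFunctionOf W η α 𝓛)
    (hϖ : ∀ {N : ℕ} [NeZero N] (f : CuspForm (Gamma0 N) 2), IsNewformOf W f →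
      (ϖ : ℝ) * W.realPeriodRat = plusPeriod f)
    (M : Matrix (Fin 2) (Fin 2) ℚ_[3]) (hM : W.IsDescendedFrobeniusMatrix M) (a b : ℚ_[3]) (hb : b ≠ 0)
    (hdict : (algebraMap ℚ_[3] ℂ_[3] a + algebraMap ℚ_[3] ℂ_[3] b * ι (ψ 2)) * algebraMap ℚ_[3] ℂ_[3] (M 1 0) =
      algebraMap ℚ_[3] ℂ_[3] (M 0 0) + (α - algebraMap ℚ_[3] ℂ_[3] M.trace))
    (Dh : W.PSLineHeightData (CyclotomicField 3 ℚ_[3]))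
    (hDh : ∀ χ : DirichletCharacter (CyclotomicField 3 ℚ_[3]) 9, (χ = ψ ∨ χ = ψ⁻¹) →
      ∀ {x y : ℚ} (hxy : W.toAffine.Nonsingular x y),
        1 < ‖(x : ℚ_[3])‖ → ‖(-(x : ℚ_[3]) / (y : ℚ_[3]))‖ ≤ ((3 : ℝ)⁻¹) ^ 3 →
          (∀ ℓ : ℕ, ℓ.Prime → W.HasNonsingularReductionAt ℓ x y) →
            Dh.pairing χ (.some x y hxy) (.some x y hxy) =
              algebraMap ℚ_[3] (CyclotomicField 3 ℚ_[3]) (CensusX42.sigmaHeight W 3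
                  ((W.baseChange ℚ_[3]).formalSigma 0) (.some x y hxy)) +
                (algebraMap ℚ_[3] (CyclotomicField 3 ℚ_[3]) a +
                    algebraMap ℚ_[3] (CyclotomicField 3 ℚ_[3]) b * χ 2) *
                  algebraMap ℚ_[3] (CyclotomicField 3 ℚ_[3])
                    (padicEval (W.baseChange ℚ_[3]).formalLog (-(x : ℚ_[3]) / (y : ℚ_[3]))) ^ 2)
    (P : W.toAffine.Point) (hP : canonicalHeight P = W.regulator) :
    gammaMahlerCoeff 3 𝓛 1 * (ϖ : ℂ_[3]) = 0 := by
  have hineq := h ψ ι hψ hι W hCM hO6 hsurj hev hsq hr η α 𝓛 ϖ hη hroot hμ hϖ M hM a b hb hdict Dh hDh P hP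
  have hsha : W.shaOrder = 0 := by
    haveI : Infinite W.sha := not_finite_iff_infinite.mp hinf
    exact Nat.card_eq_zero_of_infinite
  have hzero : (((W.shaOrder : ℚ) * (W.tamagawaProduct : ℚ) / (W.torsionOrder : ℚ) ^ 2 : ℚ) : ℂ_[3]) = 0 := by
    simp [hsha]
  rw [hzero, norm_zero, mul_zero, zero_mul] at hineq
  have hlog : algebraMap ℚ_[3] ℂ_[3] (padicLog 3 ((cyclotomicGenerator 3 : ℕ) : ℚ_[3])) ≠ 0 := by
    rw [Ne, map_eq_zero_iff _ (algebraMap ℚ_[3] ℂ_[3]).injective]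
    exact Literature.Barriers.BirchSwinnertonDyer.padicLog_cyclotomicGenerator_ne_zero 3
  have hprod : ‖gammaMahlerCoeff 3 𝓛 1 * (ϖ : ℂ_[3])‖ *
      ‖algebraMap ℚ_[3] ℂ_[3] (padicLog 3 ((cyclotomicGenerator 3 : ℕ) : ℚ_[3]))‖ = 0 :=
    le_antisymm hineq (mul_nonneg (norm_nonneg _) (norm_nonneg _))
  rcases mul_eq_zero.mp hprod with h0 | h0
  · exact norm_eq_zero.mp h0
  · exact absurd (norm_eq_zero.mp h0) hlog

/-! ### §2 The reshaped stub S5≤ (v6): the filed child implies it; GZK gives the child back -/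

/-- **Weakening: the filed child C5≤ (item 27592) implies the LEAD's reshaped stub S5≤ of skeleton `Lines/dfrob_kato.lean` v6**
(the same text with the extra binder `Finite W.sha →` after `W.analyticRank = 1 →`). Bookkeeping; nothing about BSD is proved.
[cite: Miller2011LMS, Def. 1.1 (arXiv:1010.2431 p. 3)] -/
theorem stub_pBSD3le_v6_of_item (h : PSpAdicBSDKatoSideDescendedEigenlineAtThree) :
    ∀ (ψ : DirichletCharacter (CyclotomicField 3 ℚ_[3]) 9)
      (ι : CyclotomicField 3 ℚ_[3] →ₐ[ℚ_[3]] ℂ_[3]),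
      ψ (2 : ZMod 9) = zeta 3 ℚ_[3] (CyclotomicField 3 ℚ_[3]) → Function.Injective ι →
    ∀ (W : WeierstrassCurve ℚ) [W.IsElliptic] [W.IsGloballyMinimal], ¬ W.HasCM →
      Summit.BirchSwinnertonDyer.Rank1Residual.Additive.ClassO6 W 3 → Surj W 3 →
      Even (padicValInt 3 W.minimalDiscriminantInt) →
      W.minimalDiscriminantInt / 3 ^ padicValInt 3 W.minimalDiscriminantInt % 3 = 1 →
      W.analyticRank = 1 → Finite W.sha →
      ∀ (η : DirichletCharacter ℂ_[3] (3 ^ 2)) (α : ℂ_[3]) (𝓛 : (n : ℕ) → ZMod (3 ^ n) → ℂ_[3]) (ϖ : ℚ),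
        η.IsPrimitive → α ^ 2 - ((W.psUntwistedTrace : ℤ) : ℂ_[3]) * α + 3 = 0 →
        IsPSCyclotomicLFunctionOf W η α 𝓛 →
        (∀ {N : ℕ} [NeZero N] (f : CuspForm (Gamma0 N) 2), IsNewformOf W f →
          (ϖ : ℝ) * W.realPeriodRat = plusPeriod f) →
      ∀ (M : Matrix (Fin 2) (Fin 2) ℚ_[3]), W.IsDescendedFrobeniusMatrix M →
      ∀ (a b : ℚ_[3]), b ≠ 0 →
        (algebraMap ℚ_[3] ℂ_[3] a + algebraMap ℚ_[3] ℂ_[3] b * ι (ψ 2)) * algebraMap ℚ_[3] ℂ_[3] (M 1 0) =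
          algebraMap ℚ_[3] ℂ_[3] (M 0 0) + (α - algebraMap ℚ_[3] ℂ_[3] M.trace) →
      ∀ Dh : W.PSLineHeightData (CyclotomicField 3 ℚ_[3]),
        (∀ χ : DirichletCharacter (CyclotomicField 3 ℚ_[3]) 9, (χ = ψ ∨ χ = ψ⁻¹) →
          ∀ {x y : ℚ} (hxy : W.toAffine.Nonsingular x y),
            1 < ‖(x : ℚ_[3])‖ → ‖(-(x : ℚ_[3]) / (y : ℚ_[3]))‖ ≤ ((3 : ℝ)⁻¹) ^ 3 →
              (∀ ℓ : ℕ, ℓ.Prime → W.HasNonsingularReductionAt ℓ x y) →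
                Dh.pairing χ (.some x y hxy) (.some x y hxy) =
                  algebraMap ℚ_[3] (CyclotomicField 3 ℚ_[3]) (CensusX42.sigmaHeight W 3
                      ((W.baseChange ℚ_[3]).formalSigma 0) (.some x y hxy)) +
                    (algebraMap ℚ_[3] (CyclotomicField 3 ℚ_[3]) a +
                        algebraMap ℚ_[3] (CyclotomicField 3 ℚ_[3]) b * χ 2) *
                      algebraMap ℚ_[3] (CyclotomicField 3 ℚ_[3])
                        (padicEval (W.baseChange ℚ_[3]).formalLog (-(x : ℚ_[3]) / (y : ℚ_[3]))) ^ 2) →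
      ∀ P : W.toAffine.Point, canonicalHeight P = W.regulator →
        ‖gammaMahlerCoeff 3 𝓛 1 * (ϖ : ℂ_[3])‖ *
            ‖algebraMap ℚ_[3] ℂ_[3] (padicLog 3 ((cyclotomicGenerator 3 : ℕ) : ℚ_[3]))‖ ≤
        ‖(9 * η (-1) / α ^ 2 : ℂ_[3])‖ *
          ‖(((W.shaOrder : ℚ) * (W.tamagawaProduct : ℚ) / (W.torsionOrder : ℚ) ^ 2 : ℚ) : ℂ_[3])‖ *
          ‖ι (Dh.pairing ψ P P)‖ :=
  fun ψ ι hψ hι W _ _ hCM hO6 hsurj hev hsq hr _ =>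
    h ψ ι hψ hι W hCM hO6 hsurj hev hsq hr

/-- **Conversely, granted Gross–Zagier–Kolyvagin** (`PublishedInputGZK`, route item 19921: `r_an ≤ 1 → rank = r_an ∧ Ш finite`)
the reshaped stub S5≤ (v6) gives the filed child C5≤ (item 27592) back — so the reshape removed exactly the finiteness of `Ш(E)`
on the principal-series rows with `r_an = 1`, a Kolyvagin-side input, and nothing else. Bookkeeping.
[cite: Miller2011LMS, Def. 1.1 (arXiv:1010.2431 p. 3)] -/
theorem item_of_gzk_of_stub_pBSD3le_v6 (hGZK : PublishedInputGZK)
    (h6 :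
    ∀ (ψ : DirichletCharacter (CyclotomicField 3 ℚ_[3]) 9)
      (ι : CyclotomicField 3 ℚ_[3] →ₐ[ℚ_[3]] ℂ_[3]),
      ψ (2 : ZMod 9) = zeta 3 ℚ_[3] (CyclotomicField 3 ℚ_[3]) → Function.Injective ι →
    ∀ (W : WeierstrassCurve ℚ) [W.IsElliptic] [W.IsGloballyMinimal], ¬ W.HasCM →
      Summit.BirchSwinnertonDyer.Rank1Residual.Additive.ClassO6 W 3 → Surj W 3 →
      Even (padicValInt 3 W.minimalDiscriminantInt) →
      W.minimalDiscriminantInt / 3 ^ padicValInt 3 W.minimalDiscriminantInt % 3 = 1 →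
      W.analyticRank = 1 → Finite W.sha →
      ∀ (η : DirichletCharacter ℂ_[3] (3 ^ 2)) (α : ℂ_[3]) (𝓛 : (n : ℕ) → ZMod (3 ^ n) → ℂ_[3]) (ϖ : ℚ),
        η.IsPrimitive → α ^ 2 - ((W.psUntwistedTrace : ℤ) : ℂ_[3]) * α + 3 = 0 →
        IsPSCyclotomicLFunctionOf W η α 𝓛 →
        (∀ {N : ℕ} [NeZero N] (f : CuspForm (Gamma0 N) 2), IsNewformOf W f →
          (ϖ : ℝ) * W.realPeriodRat = plusPeriod f) →
      ∀ (M : Matrix (Fin 2) (Fin 2) ℚ_[3]), W.IsDescendedFrobeniusMatrix M →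
      ∀ (a b : ℚ_[3]), b ≠ 0 →
        (algebraMap ℚ_[3] ℂ_[3] a + algebraMap ℚ_[3] ℂ_[3] b * ι (ψ 2)) * algebraMap ℚ_[3] ℂ_[3] (M 1 0) =
          algebraMap ℚ_[3] ℂ_[3] (M 0 0) + (α - algebraMap ℚ_[3] ℂ_[3] M.trace) →
      ∀ Dh : W.PSLineHeightData (CyclotomicField 3 ℚ_[3]),
        (∀ χ : DirichletCharacter (CyclotomicField 3 ℚ_[3]) 9, (χ = ψ ∨ χ = ψ⁻¹) →
          ∀ {x y : ℚ} (hxy : W.toAffine.Nonsingular x y),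
            1 < ‖(x : ℚ_[3])‖ → ‖(-(x : ℚ_[3]) / (y : ℚ_[3]))‖ ≤ ((3 : ℝ)⁻¹) ^ 3 →
              (∀ ℓ : ℕ, ℓ.Prime → W.HasNonsingularReductionAt ℓ x y) →
                Dh.pairing χ (.some x y hxy) (.some x y hxy) =
                  algebraMap ℚ_[3] (CyclotomicField 3 ℚ_[3]) (CensusX42.sigmaHeight W 3
                      ((W.baseChange ℚ_[3]).formalSigma 0) (.some x y hxy)) +
                    (algebraMap ℚ_[3] (CyclotomicField 3 ℚ_[3]) a +
                        algebraMap ℚ_[3] (CyclotomicField 3 ℚ_[3]) b * χ 2) *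
                      algebraMap ℚ_[3] (CyclotomicField 3 ℚ_[3])
                        (padicEval (W.baseChange ℚ_[3]).formalLog (-(x : ℚ_[3]) / (y : ℚ_[3]))) ^ 2) →
      ∀ P : W.toAffine.Point, canonicalHeight P = W.regulator →
        ‖gammaMahlerCoeff 3 𝓛 1 * (ϖ : ℂ_[3])‖ *
            ‖algebraMap ℚ_[3] ℂ_[3] (padicLog 3 ((cyclotomicGenerator 3 : ℕ) : ℚ_[3]))‖ ≤
        ‖(9 * η (-1) / α ^ 2 : ℂ_[3])‖ *
          ‖(((W.shaOrder : ℚ) * (W.tamagawaProduct : ℚ) / (W.torsionOrder : ℚ) ^ 2 : ℚ) : ℂ_[3])‖ *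
          ‖ι (Dh.pairing ψ P P)‖) :
    PSpAdicBSDKatoSideDescendedEigenlineAtThree :=
  fun ψ ι hψ hι W _ _ hCM hO6 hsurj hev hsq hr =>
    h6 ψ ι hψ hι W hCM hO6 hsurj hev hsq hr (hGZK W hr.le).2

end Summit.BirchSwinnertonDyer.BirchSwinnertonDyer.Theorems.CyclotomicUntwistKSepKatoSideFinitenessCorner

end
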